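import Summits.AnomalousDissipation.AnomalousDissipation.Theorems.BaireTransferRobustLoudUpgradeLine
import Summits.AnomalousDissipation.AnomalousDissipation.Theorems.BaireTransferRobustLoudUpgradeStubSteadyPersist
import Summits.AnomalousDissipation.AnomalousDissipation.Theorems.BaireTransferRobustLoudUpgradeStubPeriodicWindow
import Summits.AnomalousDissipation.AnomalousDissipation.Theorems.BaireTransferRobustLoudUpgradePeriodicPersistOfHenry
import Literature.Analysis.FluidPDE.PeriodicNSOrbitPersistsProofs
import Literature.Analysis.FluidPDE.LongTimeAverageNonneg
import Summits.AnomalousDissipation.AnomalousDissipation.Theorems.BaireTransferRobustLoudUpgradeStubWindowExhaust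
import Summits.AnomalousDissipation.AnomalousDissipation.Theorems.BaireTransferRobustLoudUpgradeStubOrbitInW
import Summits.AnomalousDissipation.AnomalousDissipation.Theorems.BaireTransferRobustLoudUpgradeStubLimitEquation
import Summits.AnomalousDissipation.AnomalousDissipation.Theorems.BaireTransferRobustLoudUpgradeStubRealizeTempered
import Summits.AnomalousDissipation.AnomalousDissipation.Theorems.BaireTransferRobustLoudUpgradeStubBudgetLimit
import Summits.AnomalousDissipation.AnomalousDissipation.Theorems.BaireTransferRobustLoudUpgradeTemperedClosed

/-!
# Stub `stub_corrRange` of the line `malkin-cone-group-orbits`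
# (crux stmt-AnomalousDissipation-1144, `BaireTransfer.RobustLoudUpgrade`, lead c16, wave 2: generic persistence)

All values of the budget-free lattice-tempered correspondence `𝚽[S, n]` of the window `n` — to a
coefficient vector `c` the set of data `(ν, τ, m, x)` (viscosity, period, mean, weighted space–time
lattice state `x = Λ·û ∈ ℓ²(ℤ × ℤ³; ℂ³)`) of the classical `τ`-periodic solutions of `NS_ν(f_c)` with
`ν, τ ∈ [1/(n+1), n+1]`, `‖m‖ ≤ n+1`, `Σ Λ‖x‖² ≤ n+1` — lie in ONE compact subset of
`ℝ × ℝ × (ℝ³ × ℓ²)`, namely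

  `[1/(n+1), n+1] × [1/(n+1), n+1] × closedBall 0 (n+1) × ι(K_W)`,

where `K_W = {z ∈ W | Σ_m Λ(m) ‖z(m)‖² ≤ n+1}` is the compact set of the lattice state space
`W ⊂ ℓ²` (families vanishing on the zero spatial modes, transversal, conjugate symmetric) given by the
lattice Rellich theorem `TimePeriodicLattice.isCompact_wt_le`
(`Literature/Analysis/FluidPDE/TimePeriodicNSLatticeCompact.lean`) and `ι : W → ℓ²` is the inclusion.
The state `x` of an orbit lies in `W` by `TimePeriodicLattice.orbit_zero_modes/transversal/conj`
(`Literature/Analysis/FluidPDE/TimePeriodicNSLatticeOrbit.lean`) and `sw_zero_mode/sw_transversal/sw_neg`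
(`Literature/Analysis/FluidPDE/PeriodicNSOrbitPersistsProofs.lean`), exactly as in `stub_orbitInW`.
This is the "values in a fixed compact set" half of the upper hemicontinuity of `𝚽[S, n]` used by the
lead's Fort-type genericity assembly.

References: G. Iooss, Arch. Rational Mech. Anal. 47 (1972), §2–3; D. Henry, LNM 840 (1981), Thm. 8.3.2;
M. K. Fort, Publ. Math. Debrecen 2 (1951). Pure proof file (no definitions).
-/

set_option linter.dupNamespace false

noncomputable section

open scoped BigOperators Topology ENNReal NNReal ComplexConjugate
open Filter Set Function TopologicalSpace MeasureTheory UnitAddTorus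

namespace Summit.AnomalousDissipation.AnomalousDissipation.Theorems.RobustLoudUpgrade.Tempered

open Literature.Analysis.FunctionSpaces Literature.Analysis.FunctionSpaces.Torus
open Literature.Analysis.FunctionSpaces.EuclideanSpace
open Literature.Analysis.FluidPDE Literature.Analysis.FluidPDE.ScalarFourier
open Literature.Analysis.FluidPDE.TimePeriodicLattice
open Summit.AnomalousDissipation.AnomalousDissipation.Theses.BaireTransfer
open Summit.AnomalousDissipation.AnomalousDissipation.Theorems.RobustLoudUpgrade

-- NOTATION START (verbatim the local notations of `Literature/Analysis/FluidPDE/PeriodicNSOrbitPersistsProofs.lean`)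
/-- The flat unit torus `T³`. -/
local notation "𝕋³" => UnitAddTorus (Fin 3)
/-- Real velocity values. -/
local notation "ℝ³" => EuclideanSpace ℝ (Fin 3)
/-- Complex coefficient values. -/
local notation "ℂ³" => EuclideanSpace ℂ (Fin 3)

/-- Local notation: the parabolic weight `Λ(n, k) = |n| + |k|²`. -/
local notation:max "Λ" m:max => (|((Prod.fst m : ℤ) : ℝ)| + freqNormSq (Prod.snd m))

/-- Local notation: the convective symbol on `ℤ × ℤ³` (as in `TimePeriodicNSLattice`). -/
local notation:max "𝐍[" a ", " b "]" m:max =>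
  (WithLp.toLp 2 (fun p : Fin 3 => ∑ j : Fin 3, ∑' m' : ℤ × (Fin 3 → ℤ),
    a m' j * (dsym j (Prod.snd m - Prod.snd m') * b (m - m') p)) : EuclideanSpace ℂ (Fin 3))

/-- Local notation: division by the weight. -/
local notation:max "𝐜" x:max => (fun mm : ℤ × (Fin 3 → ℤ) =>
  ((((|((Prod.fst mm : ℤ) : ℝ)| + freqNormSq (Prod.snd mm))⁻¹ : ℝ) : ℂ) • x mm))

/-- Local notation: multiplication by the weight. -/
local notation:max "𝐬" x:max => (fun mm : ℤ × (Fin 3 → ℤ) =>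
  ((((|((Prod.fst mm : ℤ) : ℝ)| + freqNormSq (Prod.snd mm)) : ℝ) : ℂ) • x mm))

/-- Local notation: the family of coefficients of `x ∈ W ⊂ ℓ²`. -/
local notation:max "𝐰" x:max =>
  (((x : lp (fun _ : ℤ × (Fin 3 → ℤ) => EuclideanSpace ℂ (Fin 3)) 2)) : ℤ × (Fin 3 → ℤ) → EuclideanSpace ℂ (Fin 3))

/-- Local notation: the symbol `σ_om(n,k) = 2πi om n + 4π²ν|k|² + 2πi m₀·k`. -/
local notation "σ[" om ", " ν ", " m₀ "]" => (fun mm : ℤ × (Fin 3 → ℤ) =>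
  2 * Real.pi * Complex.I * ((om : ℝ) : ℂ) * ((Prod.fst mm : ℤ) : ℂ) +
    (((4 * Real.pi ^ 2 * ν * freqNormSq (Prod.snd mm) : ℝ)) : ℂ) +
    2 * Real.pi * Complex.I * (∑ jj : Fin 3, ((m₀ jj : ℝ) : ℂ) * (((Prod.snd mm) jj : ℤ) : ℂ)))

/-- Local notation: the lattice family of the orbit `u` with period `τ`:
`û(n,k) = 𝓕(complexify ∘ (timeRoll τ u − ∫ u(0)))(n,k)`. -/
local notation:max "𝐨[" τ ", " u "]" => (fun mm : ℤ × (Fin 3 → ℤ) =>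
  mFourierCoeff (EuclideanSpace.complexify ∘ fun y : UnitAddTorus (Fin 4) => Torus.timeRoll τ u y - ∫ x, u 0 x)
    (Fin.cons (Prod.fst mm) (Prod.snd mm) : Fin 4 → ℤ))

/-- Local notation: the force family `y_F(n,k) = [k ≠ 0][n = 0] 𝓕(complexify ∘ F)(k)`. -/
local notation:max "𝐲" F:max => (fun mm : ℤ × (Fin 3 → ℤ) =>
  (ite (Prod.snd mm = 0) (0 : EuclideanSpace ℂ (Fin 3))
    (ite (Prod.fst mm = 0) (mFourierCoeff (EuclideanSpace.complexify ∘ F) (Prod.snd mm)) 0)))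

/-- Local notation: the family of coefficients of an element of `ℓ²(ℤ × ℤ³; ℂ³)`. -/
local notation:max "𝐯" x:max =>
  ((x : lp (fun _ : ℤ × (Fin 3 → ℤ) => EuclideanSpace ℂ (Fin 3)) 2) : ℤ × (Fin 3 → ℤ) → EuclideanSpace ℂ (Fin 3))

/-- Local notation: the BUDGET-FREE LATTICE-TEMPERED CORRESPONDENCE of the window `n` — to a coefficient vector `c` the set of data
`(ν, τ, m, x)` (viscosity, period, mean, weighted lattice state `x = Λû ∈ ℓ²`) of the classical time-periodic solutions of `NS_ν(f_c)`
with `ν, τ ∈ [1/(n+1), n+1]`, `‖m‖ ≤ n+1`, `Σ Λ‖x‖² ≤ n+1`. -/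
local notation "𝚽[" S ", " n "]" => (fun c : Coeff S => setOf
  (fun q : ℝ × ℝ × (EuclideanSpace ℝ (Fin 3) × lp (fun _ : ℤ × (Fin 3 → ℤ) => EuclideanSpace ℂ (Fin 3)) 2) =>
    1 / ((n : ℝ) + 1) ≤ (Prod.fst q) ∧ (Prod.fst q) ≤ (n : ℝ) + 1 ∧ 1 / ((n : ℝ) + 1) ≤ (Prod.fst (Prod.snd q)) ∧ (Prod.fst (Prod.snd q)) ≤ (n : ℝ) + 1 ∧
    ‖(Prod.fst (Prod.snd (Prod.snd q)))‖ ≤ (n : ℝ) + 1 ∧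
    (∑' mm : ℤ × (Fin 3 → ℤ), ENNReal.ofReal (Λ mm) * ‖(𝐯 ((Prod.snd (Prod.snd (Prod.snd q))))) mm‖ₑ ^ 2) ≤ ENNReal.ofReal ((n : ℝ) + 1) ∧
    ∃ (u : ℝ → UnitAddTorus (Fin 3) → EuclideanSpace ℝ (Fin 3)) (p : ℝ → UnitAddTorus (Fin 3) → ℝ),
      IsClassicalNSSolutionOn Set.univ (Prod.fst q) (fun _ => force S c) u p ∧ Function.Periodic u (Prod.fst (Prod.snd q)) ∧
      (∫ y, u 0 y) = (Prod.fst (Prod.snd (Prod.snd q))) ∧ 𝐯 ((Prod.snd (Prod.snd (Prod.snd q)))) = 𝐬 𝐨[(Prod.fst (Prod.snd q)), u]))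
-- NOTATION END

namespace CorrRangeAux

variable {W : Submodule ℝ (lp (fun _ : ℤ × (Fin 3 → ℤ) => EuclideanSpace ℂ (Fin 3)) 2)}

-- adapted from Summits/…/BaireTransferRobustLoudUpgradeStubOrbitInW.lean (`stub_orbitInW`, the element of `W`)
/-- The weighted lattice state of a classical periodic orbit of `NS_ν(f_c)` lies in the state space `W`:
an `ℓ²` element whose coefficient family is `Λ·û`, `û = 𝐨[τ, u]`, vanishes on the zero spatial modes,
is transversal and conjugate symmetric (Iooss 1972, §2). [folklore] -/
theorem mem_W_of_orbit
    (hW : ∀ x : lp (fun _ : ℤ × (Fin 3 → ℤ) => EuclideanSpace ℂ (Fin 3)) 2, x ∈ W ↔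
      (∀ n : ℤ, (x : ℤ × (Fin 3 → ℤ) → EuclideanSpace ℂ (Fin 3)) (n, 0) = 0) ∧
      (∀ mm : ℤ × (Fin 3 → ℤ), (∑ jj : Fin 3, ((mm.2 jj : ℤ) : ℂ) *
        ((x : ℤ × (Fin 3 → ℤ) → EuclideanSpace ℂ (Fin 3)) mm) jj) = 0) ∧
      (∀ mm : ℤ × (Fin 3 → ℤ), (x : ℤ × (Fin 3 → ℤ) → EuclideanSpace ℂ (Fin 3)) (-mm) =
        conjVec ((x : ℤ × (Fin 3 → ℤ) → EuclideanSpace ℂ (Fin 3)) mm)))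
    {S : Finset (Fin 3 → ℤ)} (c : Coeff S) {ν τ : ℝ}
    {u : ℝ → 𝕋³ → ℝ³} {p : ℝ → 𝕋³ → ℝ}
    (hsol : IsClassicalNSSolutionOn Set.univ ν (fun _ => force S c) u p) (hper : Function.Periodic u τ)
    {x : lp (fun _ : ℤ × (Fin 3 → ℤ) => EuclideanSpace ℂ (Fin 3)) 2} (hx : 𝐯 x = 𝐬 𝐨[τ, u]) :
    x ∈ W := by
  have hf0 : HasZeroMean (force S c) := SteadyPersist.hasZeroMean_force' c
  -- the lattice data of the orbit
  have hu0 : ∀ n : ℤ, 𝐨[τ, u] ((n, 0) : ℤ × (Fin 3 → ℤ)) = 0 := orbit_zero_modes hsol hper hf0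
  have hut := orbit_transversal hsol hper
  have huc := orbit_conj hsol hper
  refine (hW x).2 ?_
  rw [hx]
  exact ⟨sw_zero_mode (x := 𝐨[τ, u]) hu0, sw_transversal (x := 𝐨[τ, u]) hut, sw_neg (x := 𝐨[τ, u]) huc⟩

end CorrRangeAux

/-- **All values of the budget-free lattice-tempered correspondence of a window lie in one compact set.**
For every window `n` there is a compact `K ⊆ ℝ × ℝ × (ℝ³ × ℓ²)` with `𝚽[S, n] c ⊆ K` for all `c`:
`K = [1/(n+1), n+1] × [1/(n+1), n+1] × closedBall 0 (n+1) × ι{z ∈ W | Σ Λ‖z‖² ≤ n+1}`, the last factor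
compact by the lattice Rellich theorem `isCompact_wt_le` (Iooss 1972, §2–3; Henry 1981, Thm. 8.3.2;
the compact-values half of upper hemicontinuity in Fort 1951). [folklore] -/
theorem stub_corrRange : ∀ (S : Finset (Fin 3 → ℤ)) (n : ℕ),
    ∃ K : Set (ℝ × ℝ × (EuclideanSpace ℝ (Fin 3) × lp (fun _ : ℤ × (Fin 3 → ℤ) => EuclideanSpace ℂ (Fin 3)) 2)),
      IsCompact K ∧ ∀ c : Coeff S, 𝚽[S, n] c ⊆ K := by
  intro S n
  -- the state space and its compact set of states
  obtain ⟨W, hW, hWc⟩ := exists_space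
  set Kw : Set W := {z : W | ∑' m, ENNReal.ofReal (Λ m) * ‖(𝐰 z) m‖ₑ ^ 2 ≤ ENNReal.ofReal ((n : ℝ) + 1)}
  have hKwc : IsCompact Kw := isCompact_wt_le hW hWc ENNReal.ofReal_ne_top
  refine ⟨Icc (1 / ((n : ℝ) + 1)) ((n : ℝ) + 1) ×ˢ (Icc (1 / ((n : ℝ) + 1)) ((n : ℝ) + 1) ×ˢ
    (Metric.closedBall (0 : ℝ³) ((n : ℝ) + 1) ×ˢ (Subtype.val '' Kw))), ?_, ?_⟩
  · -- compactness of the product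
    exact isCompact_Icc.prod (isCompact_Icc.prod
      ((isCompact_closedBall _ _).prod (hKwc.image continuous_subtype_val)))
  · -- inclusion of the values
    intro c q hq
    obtain ⟨hν₁, hν₂, hτ₁, hτ₂, hm, hmom, u, p, hsol, hper, _hmean, hx⟩ := hq
    refine ⟨⟨hν₁, hν₂⟩, ⟨hτ₁, hτ₂⟩, ?_, ?_⟩
    · simpa only [Metric.mem_closedBall, dist_zero_right] using hm
    · have hxW : (Prod.snd (Prod.snd (Prod.snd q))) ∈ W := CorrRangeAux.mem_W_of_orbit hW c hsol hper hx
      exact ⟨⟨Prod.snd (Prod.snd (Prod.snd q)), hxW⟩, hmom, rfl⟩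

end Summit.AnomalousDissipation.AnomalousDissipation.Theorems.RobustLoudUpgrade.Tempered

end
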